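import Literature.AnabelianGeometry.SemiGraphs.StarLinkLocObj

/-!
# The star-link object IS a link under the unique-closed-edge proviso ([SemiAnbd] Def 4.2 (i) p.52; F106)

Mochizuki, *Semi-graphs of anabelioids*, Publ. RIMS **42** (2006), §4 Def 4.2 (i) p.52: "An open object
of verticial length `1` (respectively, `2`) and edge-wise length `0` (respectively, `1`) will be referred to
as a nuclear object (respectively, link)"; proof of Prop 4.7 p.57 l.38–40 ("the link contained in `𝒢₃`
which is determined by the images `v₃`, `e₃`") (kurims `paper:url-f33ace170ff4`).
[cite: MochizukiSemiAnbd2006, Def 4.2 (i), p. 52]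

PROOF-ONLY (cell abc-iut, layer L3, seat abc-iut-L3-t12 gen 10; closes the F106 proviso of the L3 lead
gen 8 / ref-e E25 for the (γ) assembly `SgAQuot.SgA.starLinkLocObj` of `StarLinkLocObj.lean`): the finite
open object on the full star `X.starAt {v₃, v₃′}` is a LINK of `Loc(𝔾, Γ)` — verticial length `2`,
edge-wise length `1` — as soon as `v₃ ≠ v₃′` and `e₃` is the UNIQUE edge of `X` all of whose branches abut
inside `{v₃, v₃′}` (the DISPLAYED no-parallel-closed-edge hypothesis `hnopar`; "untangled", §1 p.13, does
not exclude parallel closed edges).  On the way: an edge all of whose branches abut has verticial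
cardinality `2`, and conversely (`SemiGraph.vertCard_eq_two_of_forall_abuts`,
`SemiGraph.abuts_isSome_of_vertCard_eq_two`).  Nothing printed is discharged; typed ≠ proved; nothing
here takes a side on [IUTchIII] Cor. 3.12.
-/

namespace Literature.AnabelianGeometry.SemiGraphs

open CategoryTheory

universe v₁ u₁ u

namespace SemiGraph

variable (G : SemiGraph.{u})

/-- An edge all of whose branches abut to vertices has verticial cardinality `2` (its verticial
portion is the pair of its branches). [cite: MochizukiSemiAnbd2006, §1, p. 11] -/
theorem vertCard_eq_two_of_forall_abuts (e : G.Edge)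
    (h : ∀ b : G.Branch, G.edgeOf b = e → (G.abuts b).isSome) : G.vertCard e = 2 := by
  classical
  obtain ⟨b₁, b₂, hne, h₁, h₂, hall⟩ := G.two_branches e
  have hp : G.verticialPortion e = {b₁, b₂} := by
    ext b
    simp only [Set.mem_insert_iff, Set.mem_singleton_iff]
    constructor
    · rintro ⟨hb, -⟩
      exact hall b hb
    · rintro (rfl | rfl)
      · exact ⟨h₁, h _ h₁⟩
      · exact ⟨h₂, h _ h₂⟩
  unfold vertCard
  rw [hp, Nat.card_coe_set_eq, Set.ncard_pair hne]

/-- Conversely, every branch of an edge of verticial cardinality `2` abuts to a vertex.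
[cite: MochizukiSemiAnbd2006, §1, p. 12] -/
theorem abuts_isSome_of_vertCard_eq_two (e : G.Edge) (he : G.vertCard e = 2) (b : G.Branch)
    (hb : G.edgeOf b = e) : (G.abuts b).isSome := by
  classical
  by_contra hnot
  obtain ⟨b₁, b₂, hne, h₁, h₂, hall⟩ := G.two_branches e
  -- the other branch of `e`
  obtain ⟨b', hb'e, hbb'⟩ : ∃ b', G.edgeOf b' = e ∧ ∀ x, G.edgeOf x = e → x ≠ b → x = b' := by
    rcases hall b hb with rfl | rfl
    · exact ⟨b₂, h₂, fun x hx hxb => (hall x hx).resolve_left hxb⟩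
    · exact ⟨b₁, h₁, fun x hx hxb => (hall x hx).resolve_right hxb⟩
  have hsub : G.verticialPortion e ⊆ {b'} := by
    rintro x ⟨hx, hxs⟩
    refine Set.mem_singleton_iff.mpr (hbb' x hx fun hxb => ?_)
    subst hxb
    exact hnot hxs
  have hle : G.vertCard e ≤ 1 := by
    unfold vertCard
    rw [Nat.card_coe_set_eq]
    calc (G.verticialPortion e).ncard ≤ ({b'} : Set G.Branch).ncard :=
          Set.ncard_le_ncard hsub (Set.finite_singleton b')
      _ = 1 := Set.ncard_singleton b'
  omega

end SemiGraph

namespace SgAQuot.SgA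

open SemiGraphOfAnabelioids Loc

variable (R : BridgeResidual.{v₁, u₁, u}) {G : SgA.{v₁, u₁, u}} (Γ : Subgroup (Aut G))
  (X : SgA.{v₁, u₁, u}) (p : X ⟶ G) (hp : finiteEtale p.hom.hom) (hXunt : X.toSgA.graph.IsUntangled)
  (hXfin : X.toSgA.graph.IsFinite) (hXqc : X.toSgA.IsQuasiCoherent) (hXte : X.toSgA.IsTotallyElevated)
  (v₃ v₃' : X.toSgA.graph.Vertex) {e₃ : X.toSgA.graph.Edge} (b₁ b₂ : X.toSgA.graph.Branch)
  (hb₁ : X.toSgA.graph.edgeOf b₁ = e₃) (hb₂ : X.toSgA.graph.edgeOf b₂ = e₃)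
  (h₁ : X.toSgA.graph.abuts b₁ = some v₃) (h₂ : X.toSgA.graph.abuts b₂ = some v₃')
  (e₀ : X.toSgA.graph.Edge) (he₀ : X.toSgA.graph.IsClosedEdge e₀) (c₁ c₂ : X.toSgA.graph.Branch)
  (hc₁ : X.toSgA.graph.edgeOf c₁ = e₀) (hc₂ : X.toSgA.graph.edgeOf c₂ = e₀) (w : X.toSgA.graph.Vertex)
  (hw : w ∈ ({v₃, v₃'} : Set X.toSgA.graph.Vertex)) (hin : X.toSgA.graph.abuts c₁ = some w)
  (hout : ∀ u ∈ ({v₃, v₃'} : Set X.toSgA.graph.Vertex), X.toSgA.graph.abuts c₂ ≠ some u)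
  (hUS : (X.starAt {v₃, v₃'}).toSgA.IsTotallyUniversallySubCoverticial)

/-- **The star-link object has verticial length `2`** when `v₃ ≠ v₃′` (its vertices are `v₃`, `v₃′`).
[cite: MochizukiSemiAnbd2006, Def 4.2 (i), p. 52] -/
theorem starLinkLocObj_vertLength (hne : v₃ ≠ v₃') :
    (starLinkLocObj R Γ X p hp hXunt hXfin hXqc hXte v₃ v₃' b₁ b₂ hb₁ hb₂ h₁ h₂ e₀ he₀ c₁ c₂ hc₁ hc₂ w
      hw hin hout hUS).vertLength (SemiAnbdVocab.ofReal R) = 2 := by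
  change (({v₃, v₃'} : Set X.toSgA.graph.Vertex)).encard = 2
  exact Set.encard_pair hne

/-- In the full star on `S`, an edge all of whose branches abut (in `X`) inside `S` is closed, and a
closed edge of the star has all its branches abutting inside `S`. [cite: MochizukiSemiAnbd2006, §1, p. 12] -/
theorem isClosedEdge_starAt_iff (S : Set X.toSgA.graph.Vertex) (e : (X.starAt S).toSgA.graph.Edge) :
    (X.starAt S).toSgA.graph.IsClosedEdge e ↔
      ∀ b : X.toSgA.graph.Branch, X.toSgA.graph.edgeOf b = e.1 →
        ∃ v ∈ S, X.toSgA.graph.abuts b = some v := by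
  constructor
  · intro he b hb
    have hsome := (X.starAt S).toSgA.graph.abuts_isSome_of_vertCard_eq_two e he ⟨b, hb ▸ e.2⟩
      (Subtype.ext hb)
    exact (X.toSgA.graph.starSubgraph_abuts_isSome_iff S ⟨b, hb ▸ e.2⟩).mp hsome
  · intro h
    refine (X.starAt S).toSgA.graph.vertCard_eq_two_of_forall_abuts e fun c hc => ?_
    have hc' : X.toSgA.graph.edgeOf c.1 = e.1 := congrArg Subtype.val hc
    exact (X.toSgA.graph.starSubgraph_abuts_isSome_iff S c).mpr (h c.1 hc')

/-- **The star-link object has edge-wise length `1`** under the DISPLAYED proviso `hnopar`: `e₃` is the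
unique edge of `X` all of whose branches abut inside `{v₃, v₃′}` (F106: no parallel closed edge and no
closed loop at `v₃`, `v₃′`); `v₃ ≠ v₃′`. [cite: MochizukiSemiAnbd2006, Def 4.2 (i), p. 52] -/
theorem starLinkLocObj_edgeLength (hne : v₃ ≠ v₃')
    (hnopar : ∀ e : X.toSgA.graph.Edge, (∀ b : X.toSgA.graph.Branch, X.toSgA.graph.edgeOf b = e →
      ∃ v ∈ ({v₃, v₃'} : Set X.toSgA.graph.Vertex), X.toSgA.graph.abuts b = some v) → e = e₃) :
    (starLinkLocObj R Γ X p hp hXunt hXfin hXqc hXte v₃ v₃' b₁ b₂ hb₁ hb₂ h₁ h₂ e₀ he₀ c₁ c₂ hc₁ hc₂ w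
      hw hin hout hUS).edgeLength (SemiAnbdVocab.ofReal R) = 1 := by
  classical
  -- the closed edges of the star, container form = t1 form
  change ENat.card {e : (X.starAt {v₃, v₃'}).toSgA.graph.Edge //
    (SemiAnbdVocab.ofReal R).IsClosedEdge (G := X.starAt {v₃, v₃'}) e} = 1
  have hmem : e₃ ∈ (X.toSgA.graph.starSubgraph {v₃, v₃'}).edges :=
    hb₁ ▸ X.toSgA.graph.edgeOf_mem_starSubgraph_edges {v₃, v₃'} (Set.mem_insert v₃ _) h₁
  -- every branch of `e₃` abuts inside `{v₃, v₃′}`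
  have hb₁₂ : b₁ ≠ b₂ := by
    intro h; subst h; rw [h₁] at h₂; exact hne (Option.some.inj h₂)
  have he₃ : ∀ b : X.toSgA.graph.Branch, X.toSgA.graph.edgeOf b = e₃ →
      ∃ v ∈ ({v₃, v₃'} : Set X.toSgA.graph.Vertex), X.toSgA.graph.abuts b = some v := by
    intro b hb
    obtain ⟨d₁, d₂, -, hd₁, hd₂, hall⟩ := X.toSgA.graph.two_branches e₃
    have hcases : b = b₁ ∨ b = b₂ := by
      rcases hall b₁ hb₁ with e1 | e1 <;> rcases hall b₂ hb₂ with e2 | e2 <;>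
        rcases hall b hb with e | e <;> subst_vars <;> first | exact Or.inl rfl | exact Or.inr rfl |
          exact (hb₁₂ rfl).elim
    rcases hcases with rfl | rfl
    · exact ⟨v₃, Set.mem_insert v₃ _, h₁⟩
    · exact ⟨v₃', Set.mem_insert_of_mem v₃ rfl, h₂⟩
  let E₃ : {e : (X.starAt {v₃, v₃'}).toSgA.graph.Edge //
      (SemiAnbdVocab.ofReal R).IsClosedEdge (G := X.starAt {v₃, v₃'}) e} :=
    ⟨⟨e₃, hmem⟩, (SemiAnbdVocab.ofReal_isClosedEdge_iff R _ _).mpr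
      ((X.isClosedEdge_starAt_iff {v₃, v₃'} ⟨e₃, hmem⟩).mpr he₃)⟩
  haveI : Unique {e : (X.starAt {v₃, v₃'}).toSgA.graph.Edge //
      (SemiAnbdVocab.ofReal R).IsClosedEdge (G := X.starAt {v₃, v₃'}) e} :=
    { default := E₃
      uniq := fun e => by
        have hcl := (X.isClosedEdge_starAt_iff {v₃, v₃'} e.1).mp
          ((SemiAnbdVocab.ofReal_isClosedEdge_iff R _ _).mp e.2)
        exact Subtype.ext (Subtype.ext (hnopar e.1.1 hcl)) }
  rw [ENat.card_eq_coe_natCard, Nat.card_unique]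
  rfl

/-- **The star-link object IS A LINK of `Loc(𝔾, Γ)`** (Def 4.2 (i): an open object of verticial length `2`
and edge-wise length `1`) under the displayed proviso `hnopar` and `v₃ ≠ v₃′` — so that, with these, it is
print's "link contained in `𝒢₃` which is determined by the images `v₃`, `e₃`" (Prop 4.7 proof p.57).
[cite: MochizukiSemiAnbd2006, Def 4.2 (i), p. 52] -/
theorem starLinkLocObj_isLink (hne : v₃ ≠ v₃')
    (hnopar : ∀ e : X.toSgA.graph.Edge, (∀ b : X.toSgA.graph.Branch, X.toSgA.graph.edgeOf b = e →
      ∃ v ∈ ({v₃, v₃'} : Set X.toSgA.graph.Vertex), X.toSgA.graph.abuts b = some v) → e = e₃) :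
    (starLinkLocObj R Γ X p hp hXunt hXfin hXqc hXte v₃ v₃' b₁ b₂ hb₁ hb₂ h₁ h₂ e₀ he₀ c₁ c₂ hc₁ hc₂ w
      hw hin hout hUS).IsLink (SemiAnbdVocab.ofReal R) :=
  ⟨Or.inl rfl,
    starLinkLocObj_vertLength R Γ X p hp hXunt hXfin hXqc hXte v₃ v₃' b₁ b₂ hb₁ hb₂ h₁ h₂ e₀ he₀ c₁ c₂
      hc₁ hc₂ w hw hin hout hUS hne,
    starLinkLocObj_edgeLength R Γ X p hp hXunt hXfin hXqc hXte v₃ v₃' b₁ b₂ hb₁ hb₂ h₁ h₂ e₀ he₀ c₁ c₂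
      hc₁ hc₂ w hw hin hout hUS hne hnopar⟩

end SgAQuot.SgA

end Literature.AnabelianGeometry.SemiGraphs
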